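import Mathlib
import Summits.CriticalPhenomena.CardyFormulaZ2.Theorems.CardyMagicRigidityNestingRigidityStaircaseTowerProduct
import Summits.CriticalPhenomena.CardyFormulaZ2.Theorems.CardyMagicRigidityNestingRigidityStaircaseIntegrability
import Summits.CriticalPhenomena.CardyFormulaZ2.Theorems.CardyMagicRigidityNestingRigidityGapTower
import HarnessLib

/-!
# Crux `NestingRigidity`, line `ring-cloud-tomography` (r5): the GOOD EVENT costs nothing in the
# main term of (QU) — `(1 − Σ_j C (M j / L (j+1))^c) E[g_tot] ≤ E[g_tot 1_G] ≤ E[g_tot]`, both lattices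

Crux `Summit.CriticalPhenomena.CardyFormulaZ2.Theses.CardyMagicRigidity.NestingRigidity`
(stmt-CriticalPhenomena-4835), line `ring-cloud-tomography`, stub R2' `stub_staircaseDecoupling`,
input (QU) of `staircaseDecoupling_of_inputs` (p122218), conjunct (cmp); sequel to
`…StaircaseTowerProduct` (`E[g_tot] = E.towerMoment (w t) δ r · ∏_j E[w_j^{N_j}]`).  The normaliser
of (QU) is `J = E[g_tot 1_G]`, `G` = "no loop meets `B̄(0, M j₁)` and `ℂ ∖ B(0, L j₂)`, `j₁ < j₂`".
Here (registered anchor `staircase_integral_gtot_good_ge`): inserting `1_G` changes `E[g_tot]` by a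
factor in `[1 − Σ_j C (M j / L (j+1))^c, 1]` — §1 measurability of "some loop of `X_δ` satisfies `Q`",
a union bound; §2 `Gᶜ ⊆ ⋃_j {gap j crossed}`, and on "gap `j` crossed" the gap tower `j` is EMPTY
(`towerCount_eq_zero_of_loop_cross_latticeEnsembles`), so `g_tot = g^{(j)}` (no factor `w_j^{N_j}`)
there, while `g^{(j)} ≤ g_tot` everywhere as the design keeps `w_j ≥ 1`; §3 `g^{(j)}` is a cylinder
function of coordinates OFF the gap annulus `j`, so the landed TILTED rarity of gap crossings
(`GapCrossing.setIntegral_loopCross_le_zEns/_tEns`, from the tree's proved RSW bounds) gives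
`∫_{gap j crossed} g_tot ≤ C (M j / L (j+1))^c E[g_tot]` (`4 M j ≤ L (j+1)`, `c₀ δ ≤ M j`, `L j + 2δ ≤ M j`).
-/

noncomputable section

open MeasureTheory ProbabilityTheory Set Filter Metric
open scoped Real Topology BigOperators

namespace Summit.CriticalPhenomena.CardyFormulaZ2.Cruxes.NestingRigidity.RingCloudTomography

open Literature.Probability.RandomPlanarGeometry Literature.Probability.Percolation
  Literature.Probability.LatticeModels
open Summit.CriticalPhenomena.CardyFormulaZ2.Cruxes.NestingRigidity.PositiveConeWeightDoubling
  (magicWeight)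
open Summit.CriticalPhenomena.CardyFormulaZ2.Cruxes.NestingRigidity.MarkovCascadeOneGeneration
  (dist_meshPoint_medialPoint_le)

-- Local notation: the staircase cloud, its tower loops, the good event, the gap-crossing event.
local notation3 "Stair(" k ", " L ", " M ", " t ", " r ")" =>
  Cloud.mk 1 k (fun _ ↦ (0 : ℂ)) (fun _ ↦ r) (fun _ ↦ t) (fun _ ↦ (0 : ℂ)) L M (fun _ ↦ -t / ((k : ℕ) : ℝ))
local notation3 "Tow(" c ", " k ", " L ", " M ", " r ")" =>
  {u ∈ LoopConfig.loops c | (Metric.closedBall (0 : ℂ) r ⊆ {z | u.wind z ≠ 0} ∧ u.range ⊆ Metric.ball (0 : ℂ) 1) ∨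
    ∃ j : Fin k, (j : ℕ) + 1 < k ∧ Metric.closedBall (0 : ℂ) ((M : Fin k → ℝ) j) ⊆ {z | u.wind z ≠ 0} ∧
      ∀ l : Fin k, j < l → u.range ⊆ Metric.ball (0 : ℂ) ((L : Fin k → ℝ) l)}
local notation3 "Good(" c ", " k ", " L ", " M ")" =>
  (∀ u ∈ LoopConfig.loops c, ∀ j₁ j₂ : Fin k, j₁ < j₂ →
    ¬ ((u.range ∩ Metric.closedBall (0 : ℂ) ((M : Fin k → ℝ) j₁)).Nonempty ∧
      (u.range ∩ (Metric.ball (0 : ℂ) ((L : Fin k → ℝ) j₂))ᶜ).Nonempty))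
local notation3 "LCross(" E ", " δ ", " a ", " b ")" =>
  {ω | ∃ v ∈ (LoopEnsemble.X E δ ω).loops, (v.range ∩ closedBall (0 : ℂ) a).Nonempty ∧ (v.range ∩ (ball (0 : ℂ) b)ᶜ).Nonempty}
local notation3 "GapErase(" c ", " t ", " r ", " n ", " L ", " M ", " j ")" =>
  magicWeight t ^ towerCount c 0 r 1 *
    ∏ i ∈ Finset.univ.erase (j : Fin n), magicWeight (t + ((i : ℕ) + 1) * (-t / ((n + 1 : ℕ) : ℝ))) ^
      towerCount c 0 ((M : Fin (n + 1) → ℝ) (Fin.castSucc i)) ((L : Fin (n + 1) → ℝ) (Fin.succ i))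

namespace Staircase

/-! ## §1 Measurability of loop events; a union bound for set integrals -/

/-- `{ω | ∃ u ∈ f '' S ω, Q u}` is measurable for a random subset `S ω` of a countable index type with
measurable membership events and a deterministic predicate `Q`. -/
theorem measurableSet_exists_mem_image {Ω K α : Type*} [MeasurableSpace Ω] [Countable K]
    (f : K → α) {S : Ω → Set K} (hS : ∀ k, Measurable fun ω ↦ k ∈ S ω) (Q : α → Prop) :
    MeasurableSet {ω | ∃ u ∈ f '' S ω, Q u} := by
  have e : {ω | ∃ u ∈ f '' S ω, Q u} = {ω | ∃ k, k ∈ S ω ∧ Q (f k)} := by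
    ext ω
    exact ⟨fun ⟨_, ⟨k, hk, hfk⟩, hq⟩ ↦ ⟨k, hk, hfk ▸ hq⟩, fun ⟨k, hk, hq⟩ ↦ ⟨f k, ⟨k, hk, rfl⟩, hq⟩⟩
  rw [e]
  exact (Measurable.exists fun k ↦ (hS k).and measurable_const).setOf

/-- **"Some loop of `X_δ` satisfies `Q`" is a measurable event on both lattice ensembles**, for
every deterministic predicate `Q` (e.g. the gap-crossing events). -/
theorem measurableSet_exists_loop : ∀ E ∈ latticeEnsembles, ∀ (δ : ℝ) (Q : UnbasedLoop ℂ → Prop),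
    MeasurableSet {ω | ∃ u ∈ (E.X δ ω).loops, Q u} := by
  intro E hE δ Q
  haveI := countable_sigma_hexLoop
  simp only [latticeEnsembles, Set.mem_insert_iff, Set.mem_singleton_iff] at hE
  rcases hE with rfl | rfl
  · simp_rw [loops_zEns_eq_image]
    exact measurableSet_exists_mem_image _ measurable_mem_bondIndex Q
  · simp_rw [loops_tEns_eq_image]
    exact measurableSet_exists_mem_image _ measurable_mem_siteIndex Q

/-- **Union bound**: if `Gᶜ` is covered by finitely many measurable events `C i` and `g ≥ 0` is
integrable, then `∫ g 1_{Gᶜ} ≤ Σ_i ∫_{C i} g`. -/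
theorem integral_mul_indicator_compl_le_sum {Ω : Type*} [MeasurableSpace Ω] {P : Measure Ω}
    {ι : Type*} (s : Finset ι) {G : Set Ω} {C : ι → Set Ω} (hC : ∀ i ∈ s, MeasurableSet (C i))
    (hcover : Gᶜ ⊆ ⋃ i ∈ s, C i) {g : Ω → ℝ} (hg0 : ∀ ω, 0 ≤ g ω) (hgi : Integrable g P) :
    ∫ ω, g ω * Gᶜ.indicator 1 ω ∂P ≤ ∑ i ∈ s, ∫ ω in C i, g ω ∂P := by
  have hpt : ∀ ω, g ω * Gᶜ.indicator (1 : Ω → ℝ) ω ≤ ∑ i ∈ s, (C i).indicator g ω := fun ω ↦ by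
    by_cases hω : ω ∈ Gᶜ
    · obtain ⟨i, hi, hωi⟩ : ∃ i ∈ s, ω ∈ C i := by simpa only [Set.mem_iUnion, exists_prop] using hcover hω
      rw [Set.indicator_of_mem hω, Pi.one_apply, mul_one]
      refine le_trans ?_ (Finset.single_le_sum (fun i' _ ↦ Set.indicator_nonneg (fun _ _ ↦ hg0 _) ω) hi)
      rw [Set.indicator_of_mem hωi]
    · rw [Set.indicator_of_notMem hω, mul_zero]
      exact Finset.sum_nonneg fun i _ ↦ Set.indicator_nonneg (fun _ _ ↦ hg0 _) ω
  calc ∫ ω, g ω * Gᶜ.indicator 1 ω ∂P ≤ ∫ ω, ∑ i ∈ s, (C i).indicator g ω ∂P :=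
        integral_mono_of_nonneg (Eventually.of_forall fun ω ↦ mul_nonneg (hg0 ω)
          (Set.indicator_nonneg (fun _ _ ↦ zero_le_one) ω))
          (integrable_finsetSum s fun i hi ↦ hgi.indicator (hC i hi)) (Eventually.of_forall hpt)
    _ = ∑ i ∈ s, ∫ ω in C i, g ω ∂P := by
        rw [integral_finsetSum s fun i hi ↦ hgi.indicator (hC i hi)]
        exact Finset.sum_congr rfl fun i hi ↦ integral_indicator (hC i hi)

/-! ## §2 `Gᶜ ⊆ ⋃_j {gap j crossed}`; on a crossed gap `g_tot` loses the factor `w_j^{N_j}` -/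

section GapBookkeeping

variable {t r : ℝ} {n : ℕ} {L M : Fin (n + 1) → ℝ}

/-- **The bad event is covered by the `n` gap-crossing events**: a loop meeting `B̄(0, M j₁)` and
`ℂ ∖ B(0, L j₂)` for rings `j₁ < j₂` crosses the gap `A(0; M j₁, L (j₁+1))` (`L (j₁+1) ≤ L j₂`). -/
theorem compl_good_subset_iUnion (hLM : ∀ j, L j < M j) (hsep : ∀ j l, j < l → M j ≤ L l) (E : LoopEnsemble)
    (δ : ℝ) : {ω | Good(E.X δ ω, n + 1, L, M)}ᶜ ⊆
      ⋃ j ∈ (Finset.univ : Finset (Fin n)), LCross(E, δ, M (Fin.castSucc j), L (Fin.succ j)) := by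
  intro ω hω
  simp only [Set.mem_compl_iff, Set.mem_setOf_eq, not_forall, not_not, exists_prop] at hω
  obtain ⟨u, hu, j₁, j₂, hj, h₁, z, hzu, hz⟩ := hω
  have hjl : j₁ ≠ Fin.last n := fun h ↦ not_lt.2 (Fin.le_last j₂) (h ▸ hj)
  obtain ⟨j, rfl⟩ := Fin.exists_castSucc_eq.2 hjl
  simp only [Set.mem_iUnion, Finset.mem_univ, exists_true_left, Set.mem_setOf_eq]
  refine ⟨j, u, hu, h₁, z, hzu, fun hz' ↦ hz (ball_subset_ball ?_ hz')⟩
  exact inner_mono hLM hsep (Fin.castSucc_lt_iff_succ_le.1 hj)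

/-- **The gap-tower weights are `≥ 1`** when `t ≤ 0` and `t + (−t/(n+1)) ≥ −2π/3`: every phase
`θ_j = t + (j+1)(−t/(n+1))`, `j < n`, lies in `[−2π/3, 0]`. -/
theorem one_le_gapWeight (ht : t ≤ 0) (ht2 : -(2 * π / 3) ≤ t + -t / (n + 1 : ℕ)) (j : Fin n) :
    1 ≤ magicWeight (t + ((j : ℕ) + 1) * (-t / (n + 1 : ℕ))) := by
  have hq : 0 ≤ -t / (n + 1 : ℕ) := div_nonneg (neg_nonneg.2 ht) (Nat.cast_nonneg _)
  have hj0 : (0 : ℝ) ≤ (j : ℕ) := Nat.cast_nonneg _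
  have hj : ((j : ℕ) : ℝ) + 1 ≤ (n + 1 : ℕ) := by
    have := j.2; push_cast; exact_mod_cast (by omega : (j : ℕ) + 1 ≤ n + 1)
  have hk : -t / (n + 1 : ℕ) * (n + 1 : ℕ) = -t := div_mul_cancel₀ _ (Nat.cast_pos.2 (Nat.succ_pos n)).ne'
  exact one_le_magicWeight_of_mem_Icc ⟨by nlinarith [mul_nonneg hj0 hq], by nlinarith [mul_le_mul_of_nonneg_right hj hq]⟩

/-- **On "gap `j` crossed", `g_tot = g^{(j)}`** (the product of the tower weights WITHOUT the factor
of gap `j`), on both lattices: a crossing loop empties the gap tower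
(`towerCount_eq_zero_of_loop_cross_latticeEnsembles`). -/
theorem finprod_tow_eq_erase_of_cross : ∀ E ∈ latticeEnsembles, ∀ {δ : ℝ}, 0 < δ → ∀ (ω : E.Ω),
    0 < r → (∀ j, r ≤ L j) → (∀ j, 1 ≤ L j) → (∀ j, L j < M j) → (∀ j l, j < l → M j ≤ L l) →
    ∀ j : Fin n, ω ∈ LCross(E, δ, M (Fin.castSucc j), L (Fin.succ j)) →
    ∏ᶠ u ∈ Tow(E.X δ ω, n + 1, L, M, r), u.nestingFactor (Stair(n + 1, L, M, t, r)).density =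
      GapErase(E.X δ ω, t, r, n, L, M, j) := by
  intro E hE δ hδ ω hr hrL hL1 hLM hsep j hω
  rw [finprod_tow_eq_pow_mul_prod E hE hδ ω hr hrL hL1 hLM hsep,
    ← Finset.mul_prod_erase _ _ (Finset.mem_univ j),
    towerCount_eq_zero_of_loop_cross_latticeEnsembles E hE hδ ω 0 _ _ hω, pow_zero, one_mul]

/-- **`g^{(j)} ≤ g_tot` everywhere** (the dropped factor `w_j^{N_j}` is `≥ 1`, the kept ones `≥ 0`). -/
theorem erase_le_finprod_tow : ∀ E ∈ latticeEnsembles, ∀ {δ : ℝ}, 0 < δ → ∀ (ω : E.Ω),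
    t ∈ Set.Icc (-(5 * π / 6)) 0 → -(2 * π / 3) ≤ t + -t / (n + 1 : ℕ) →
    0 < r → (∀ j, r ≤ L j) → (∀ j, 1 ≤ L j) → (∀ j, L j < M j) → (∀ j l, j < l → M j ≤ L l) →
    ∀ j : Fin n,
    0 ≤ GapErase(E.X δ ω, t, r, n, L, M, j) ∧
    GapErase(E.X δ ω, t, r, n, L, M, j) ≤
      ∏ᶠ u ∈ Tow(E.X δ ω, n + 1, L, M, r), u.nestingFactor (Stair(n + 1, L, M, t, r)).density := by
  intro E hE δ hδ ω ht ht2 hr hrL hL1 hLM hsep j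
  have hw0 : 0 ≤ magicWeight t := magicWeight_nonneg_of_mem_Icc ⟨ht.1, by linarith [ht.2, Real.pi_pos]⟩
  have hw1 := one_le_gapWeight ht.2 ht2
  have h0 : 0 ≤ GapErase(E.X δ ω, t, r, n, L, M, j) :=
    mul_nonneg (pow_nonneg hw0 _) (Finset.prod_nonneg fun i _ ↦ pow_nonneg (zero_le_one.trans (hw1 i)) _)
  refine ⟨h0, ?_⟩
  rw [finprod_tow_eq_pow_mul_prod E hE hδ ω hr hrL hL1 hLM hsep,
    ← Finset.mul_prod_erase _ _ (Finset.mem_univ j), ← mul_assoc, mul_comm (magicWeight t ^ _) (_ ^ _), mul_assoc]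
  exact le_mul_of_one_le_left h0 (one_le_pow₀ (hw1 j))

end GapBookkeeping

/-! ## §3 `g^{(j)}` reads only coordinates off the gap annulus `j`: tilted rarity of the crossing -/

/-- **Outer towers are observables of the complement of the annulus** (bond-`ℤ²`, `δ > 0`): edges
with medial point outside `B̄(x, ρ)`, `b + 2δ ≤ ρ`, miss the lattice edges with both endpoints
within `b + δ` of `x` (an endpoint is within `|δ|` of the medial point). -/
theorem disjoint_outer_annulus_zEns {δ : ℝ} (hδ : 0 < δ) (x : ℂ) {b ρ : ℝ} (hbρ : b + 2 * δ ≤ ρ) (a R : ℝ) :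
    Disjoint {e : Sym2 (Site 2) | medialPoint δ e ∈ ball x R \ closedBall x ρ}
      {e : Sym2 (Site 2) | e ∈ (zdGraph 2).edgeSet ∧ ∀ s ∈ e,
        s ∈ {s : Site 2 | a + δ < dist (meshPoint δ s) x ∧ dist (meshPoint δ s) x ≤ b + δ}} := by
  refine Set.disjoint_left.2 fun e heM ⟨hE, hS⟩ ↦ ?_
  have hm : ρ < dist (medialPoint δ e) x := not_le.1 fun h ↦ heM.2 (mem_closedBall.2 h)
  revert hE hS hm heM
  refine Sym2.ind (fun p q heM hE hS hm ↦ ?_) e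
  have h1 := dist_meshPoint_medialPoint_le (δ := δ) ((SimpleGraph.mem_edgeSet _).1 hE) (Sym2.mem_mk_left p q)
  rw [abs_of_pos hδ] at h1
  linarith [(hS p (Sym2.mem_mk_left p q)).2, dist_triangle (medialPoint δ s(p, q)) (meshPoint δ p) x,
    dist_comm (meshPoint δ p) (medialPoint δ s(p, q))]

section Tilted

variable {t r : ℝ} {n : ℕ} {L M : Fin (n + 1) → ℝ}

/-- Inner gaps end inside the hole of gap `j`: `L (i+1) ≤ M j` for `i < j`. -/
theorem succ_le_castSucc_of_lt (hLM : ∀ j, L j < M j) (hsep : ∀ j l, j < l → M j ≤ L l) {i j : Fin n}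
    (h : i < j) : L (Fin.succ i) ≤ M (Fin.castSucc j) :=
  (inner_mono hLM hsep (Fin.castSucc_lt_iff_succ_le.1 (Fin.castSucc_lt_castSucc_iff.2 h))).trans (hLM _).le

/-- Outer gaps start `2δ` beyond gap `j`: `L (j+1) + 2δ ≤ M i` for `j < i` (`L i + 2δ ≤ M i`). -/
theorem succ_add_le_castSucc_of_lt {δ : ℝ} (hgap : ∀ j, L j + 2 * δ ≤ M j) (hLM : ∀ j, L j < M j)
    (hsep : ∀ j l, j < l → M j ≤ L l) {i j : Fin n} (h : j < i) :
    L (Fin.succ j) + 2 * δ ≤ M (Fin.castSucc i) := by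
  have := inner_mono hLM hsep (Fin.castSucc_lt_iff_succ_le.1 (Fin.castSucc_lt_castSucc_iff.2 h))
  linarith [hgap (Fin.castSucc i)]

/-- **`g^{(j)}` is measurable, non-negative, dominated by `g_tot`, hence integrable**, both lattices. -/
theorem integrable_erase : ∀ E ∈ latticeEnsembles, ∀ {δ : ℝ}, 0 < δ →
    t ∈ Set.Icc (-(5 * π / 6)) 0 → -(2 * π / 3) ≤ t + -t / (n + 1 : ℕ) →
    0 < r → (∀ j, r ≤ L j) → (∀ j, 1 ≤ L j) → (∀ j, L j < M j) → (∀ j l, j < l → M j ≤ L l) → ∀ j : Fin n,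
    Measurable (fun ω ↦ GapErase(E.X δ ω, t, r, n, L, M, j)) ∧
    Integrable (fun ω ↦ GapErase(E.X δ ω, t, r, n, L, M, j)) E.P := by
  intro E hE δ hδ ht ht2 hr hrL hL1 hLM hsep j
  have hm : Measurable (fun ω ↦ GapErase(E.X δ ω, t, r, n, L, M, j)) :=
    ((measurable_towerCount E hE δ 0 r 1).const_pow _).mul
      (TowerIndependence.measurable_prod_pow_towerCount E hE _
        (fun i : Fin n ↦ magicWeight (t + ((i : ℕ) + 1) * (-t / (n + 1 : ℕ)))) _ _ δ 0)
  refine ⟨hm, Integrable.mono' (integrable_finprod_tow (t := t) E hE hδ (Nat.succ_pos n) hr hrL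
    (fun j ↦ one_pos.trans_le (hL1 j)) hLM hsep) hm.aestronglyMeasurable (Eventually.of_forall fun ω ↦ ?_)⟩
  obtain ⟨h0, hle⟩ := erase_le_finprod_tow E hE hδ ω ht ht2 hr hrL hL1 hLM hsep j
  rw [Real.norm_eq_abs, abs_of_nonneg h0]
  exact hle

/-- **Tilted rarity of a gap crossing against `g^{(j)}`, on both lattices**: with the constants
`c, C, c₀` of `GapCrossing.setIntegral_loopCross_le_zEns` / `_tEns`, for a staircase as above and a
gap `j` with `c₀ δ ≤ M j`, `4 M j ≤ L (j+1)`, `∫_{gap j crossed} g^{(j)} ≤ C (M j / L (j+1))^c ∫ g^{(j)}`: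
the window tower and the gap towers `i ≠ j` read only edges (sites) off the annulus `A(0; M j, L (j+1))`
(`GapCrossing.disjoint_window_annulus_zEns`, `disjoint_outer_annulus_zEns`). -/
theorem exists_setIntegral_cross_erase_le : ∀ E ∈ latticeEnsembles, ∃ c C c₀ : ℝ, 0 < c ∧ 0 < C ∧ 0 < c₀ ∧
    ∀ {δ t r : ℝ} {n : ℕ} {L M : Fin (n + 1) → ℝ}, 0 < δ → t ∈ Set.Icc (-(5 * π / 6)) 0 →
    -(2 * π / 3) ≤ t + -t / (n + 1 : ℕ) → 0 < r → (∀ j, r ≤ L j) → (∀ j, 1 ≤ L j) →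
    (∀ j, L j + 2 * δ ≤ M j) → (∀ j l, j < l → M j ≤ L l) → ∀ j : Fin n, c₀ * δ ≤ M (Fin.castSucc j) →
    4 * M (Fin.castSucc j) ≤ L (Fin.succ j) →
    ∫ ω in LCross(E, δ, M (Fin.castSucc j), L (Fin.succ j)),
        GapErase(E.X δ ω, t, r, n, L, M, j) ∂E.P ≤
      C * (M (Fin.castSucc j) / L (Fin.succ j)) ^ c *
        ∫ ω, GapErase(E.X δ ω, t, r, n, L, M, j) ∂E.P := by
  intro E hE
  have hEm := hE
  simp only [latticeEnsembles, Set.mem_insert_iff, Set.mem_singleton_iff] at hE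
  rcases hE with rfl | rfl
  · obtain ⟨c, C, c₀, hc, hC, hc₀, hbd⟩ := GapCrossing.setIntegral_loopCross_le_zEns
    refine ⟨c, C, c₀, hc, hC, hc₀, fun {δ t r n L M} hδ ht ht2 hr hrL hL1 hgap hsep j hc₀M h4 ↦ ?_⟩
    have hLM : ∀ j, L j < M j := fun j ↦ by linarith [hgap j]
    obtain ⟨hm, hi⟩ := integrable_erase zEns hEm hδ ht ht2 hr hrL hL1 hLM hsep j
    obtain ⟨Me, hM1, hM2, hdisj⟩ : ∃ Me : Set (Sym2 (Site 2)),
        (∀ e, medialPoint δ e ∈ ball (0 : ℂ) 1 \ closedBall 0 r → e ∈ Me) ∧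
        (∀ i ∈ Finset.univ.erase j, ∀ e,
          medialPoint δ e ∈ ball (0 : ℂ) (L (Fin.succ i)) \ closedBall 0 (M (Fin.castSucc i)) → e ∈ Me) ∧
        Disjoint Me {e : Sym2 (Site 2) | e ∈ (zdGraph 2).edgeSet ∧ ∀ s ∈ e, s ∈ {s : Site 2 |
          M (Fin.castSucc j) + δ < dist (meshPoint δ s) 0 ∧ dist (meshPoint δ s) 0 ≤ L (Fin.succ j) + δ}} := by
      refine ⟨{e | medialPoint δ e ∈ ball (0 : ℂ) 1 \ closedBall 0 r} ∪
        {e | ∃ i ∈ Finset.univ.erase j, medialPoint δ e ∈ ball (0 : ℂ) (L (Fin.succ i)) \ closedBall 0 (M (Fin.castSucc i))},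
        fun e he ↦ Or.inl he, fun i hi e he ↦ Or.inr ⟨i, hi, he⟩, Set.disjoint_union_left.2
          ⟨GapCrossing.disjoint_window_annulus_zEns hδ 0 ((hL1 _).trans (hLM _).le) _ r,
            Set.disjoint_left.2 fun e he he' ↦ ?_⟩⟩
      obtain ⟨i, hi, hei⟩ := he
      rcases lt_or_gt_of_ne (Finset.ne_of_mem_erase hi) with h | h
      · exact Set.disjoint_left.1 (GapCrossing.disjoint_window_annulus_zEns hδ 0
          (succ_le_castSucc_of_lt hLM hsep h) _ _) hei he'
      · exact Set.disjoint_left.1 (disjoint_outer_annulus_zEns hδ 0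
          (succ_add_le_castSucc_of_lt hgap hLM hsep h) _ _) hei he'
    refine hbd 0 _ _ δ hδ hc₀M h4 Me _ hdisj hm hi
      (fun ω ↦ (erase_le_finprod_tow zEns hEm hδ ω ht ht2 hr hrL hL1 hLM hsep j).1) fun ω ↦ ?_
    rw [TowerIndependence.towerCount_zEns_inter δ ω Me 0 r 1 hM1,
      TowerIndependence.prod_pow_towerCount_zEns_inter _ _ _ _ δ 0 Me hM2 ω]
  · obtain ⟨c, C, c₀, hc, hC, hc₀, hbd⟩ := GapCrossing.setIntegral_loopCross_le_tEns
    refine ⟨c, C, c₀, hc, hC, hc₀, fun {δ t r n L M} hδ ht ht2 hr hrL hL1 hgap hsep j hc₀M h4 ↦ ?_⟩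
    have hLM : ∀ j, L j < M j := fun j ↦ by linarith [hgap j]
    obtain ⟨hm, hi⟩ := integrable_erase tEns hEm hδ ht ht2 hr hrL hL1 hLM hsep j
    obtain ⟨S, hS1, hS2, hdisj⟩ : ∃ S : Set (Site 2),
        (∀ w, triMeshPoint δ w ∈ ball (0 : ℂ) (1 + δ) \ closedBall 0 (r - δ) → w ∈ S) ∧
        (∀ i ∈ Finset.univ.erase j, ∀ w, triMeshPoint δ w ∈
          ball (0 : ℂ) (L (Fin.succ i) + δ) \ closedBall 0 (M (Fin.castSucc i) - δ) → w ∈ S) ∧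
        Disjoint S {s : Site 2 | M (Fin.castSucc j) + δ < ‖triMeshPoint δ s - 0‖ ∧
          ‖triMeshPoint δ s - 0‖ ≤ L (Fin.succ j) - δ} := by
      refine ⟨{w | triMeshPoint δ w ∈ ball (0 : ℂ) (1 + δ) \ closedBall 0 (r - δ)} ∪
        {w | ∃ i ∈ Finset.univ.erase j, triMeshPoint δ w ∈
          ball (0 : ℂ) (L (Fin.succ i) + δ) \ closedBall 0 (M (Fin.castSucc i) - δ)},
        fun w hw ↦ Or.inl hw, fun i hi w hw ↦ Or.inr ⟨i, hi, hw⟩, Set.disjoint_union_left.2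
          ⟨Set.disjoint_left.2 fun w hw hw' ↦ ?_, Set.disjoint_left.2 fun w hw hw' ↦ ?_⟩⟩
      · obtain ⟨h2, -⟩ := hw'
        rw [sub_zero] at h2
        linarith [mem_ball_zero_iff.1 hw.1, hL1 (Fin.castSucc j), hLM (Fin.castSucc j)]
      · obtain ⟨i, hi, hwi⟩ := hw
        obtain ⟨h2, h3⟩ := hw'
        rw [sub_zero] at h2 h3
        rcases lt_or_gt_of_ne (Finset.ne_of_mem_erase hi) with h | h
        · linarith [mem_ball_zero_iff.1 hwi.1, succ_le_castSucc_of_lt hLM hsep h]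
        · have h4' : M (Fin.castSucc i) - δ < ‖triMeshPoint δ w‖ :=
            not_le.1 fun h' ↦ hwi.2 (mem_closedBall_zero_iff.2 h')
          linarith [succ_add_le_castSucc_of_lt hgap hLM hsep h]
    refine hbd 0 _ _ δ hδ hc₀M h4 S _ hdisj hm hi
      (fun ω ↦ (erase_le_finprod_tow tEns hEm hδ ω ht ht2 hr hrL hL1 hLM hsep j).1) fun ω ↦ ?_
    rw [TowerIndependence.towerCount_tEns_inter hδ.le ω S 0 r 1 hS1,
      TowerIndependence.prod_pow_towerCount_tEns_inter _ _ _ _ hδ.le 0 S hS2 ω]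

end Tilted

/-! ## §4 Assembly (registered anchor) -/

end Staircase

open Staircase in
/-- **Registered anchor — the good event costs nothing in the main term of (QU), both lattices.**
For `E ∈ latticeEnsembles` there are `c, C, c₀ > 0` (from the landed tilted gap-crossing bounds) such
that for every mesh `δ > 0`, charge `t ∈ [−5π/6, 0]` with `t + (−t/(n+1)) ≥ −2π/3` (gap-tower weights
`≥ 1`), every staircase with `n + 1` rings (`0 < r ≤ L j`, `1 ≤ L j`, `L j + 2δ ≤ M j`, `M j ≤ L l` for
`j < l`) with wide gaps above the lattice threshold (`4 M j ≤ L (j+1)`, `c₀ δ ≤ M j`), the functional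
`g_tot` of (QU) is integrable, `≥ 0`, and with `G` the good event of (QU):
`(1 − Σ_{j<n} C (M j / L (j+1))^c) ∫ g_tot ≤ ∫ g_tot 1_G ≤ ∫ g_tot`.  With
`staircase_integral_gtot_eq_prod` this is conjunct (cmp) of (QU) up to the tilted drift identity. -/
theorem staircase_integral_gtot_good_ge : ∀ E ∈ latticeEnsembles, ∃ c C c₀ : ℝ, 0 < c ∧ 0 < C ∧ 0 < c₀ ∧
    ∀ (δ t r : ℝ) (n : ℕ) (L M : Fin (n + 1) → ℝ), 0 < δ → t ∈ Set.Icc (-(5 * π / 6)) 0 →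
    -(2 * π / 3) ≤ t + -t / (n + 1 : ℕ) → 0 < r → (∀ j, r ≤ L j) → (∀ j, 1 ≤ L j) → (∀ j, L j + 2 * δ ≤ M j) →
    (∀ j l, j < l → M j ≤ L l) → (∀ j : Fin n, c₀ * δ ≤ M (Fin.castSucc j)) →
    (∀ j : Fin n, 4 * M (Fin.castSucc j) ≤ L (Fin.succ j)) → ∀ (gtot : E.Ω → ℝ) (G : Set E.Ω),
      (∀ ω, gtot ω = ∏ᶠ u ∈ {u ∈ (E.X δ ω).loops | (Metric.closedBall (0 : ℂ) r ⊆ {z | u.wind z ≠ 0} ∧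
          u.range ⊆ Metric.ball (0 : ℂ) 1) ∨ ∃ j : Fin (n + 1), (j : ℕ) + 1 < n + 1 ∧
          Metric.closedBall (0 : ℂ) (M j) ⊆ {z | u.wind z ≠ 0} ∧ ∀ l : Fin (n + 1), j < l → u.range ⊆ Metric.ball (0 : ℂ) (L l)},
        u.nestingFactor (Cloud.mk 1 (n + 1) (fun _ ↦ 0) (fun _ ↦ r) (fun _ ↦ t) (fun _ ↦ 0) L M
          (fun _ ↦ -t / (n + 1 : ℕ))).density) →
      (G = {ω | ∀ u ∈ (E.X δ ω).loops, ∀ j₁ j₂ : Fin (n + 1), j₁ < j₂ →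
        ¬ ((u.range ∩ Metric.closedBall (0 : ℂ) (M j₁)).Nonempty ∧ (u.range ∩ (Metric.ball (0 : ℂ) (L j₂))ᶜ).Nonempty)}) →
      Integrable gtot E.P ∧ (∀ ω, 0 ≤ gtot ω) ∧
      ∫ ω, gtot ω * G.indicator 1 ω ∂E.P ≤ ∫ ω, gtot ω ∂E.P ∧
      (1 - ∑ j : Fin n, C * (M (Fin.castSucc j) / L (Fin.succ j)) ^ c) * ∫ ω, gtot ω ∂E.P ≤
        ∫ ω, gtot ω * G.indicator 1 ω ∂E.P := by
  intro E hE
  obtain ⟨c, C, c₀, hc, hC, hc₀, hbd⟩ := exists_setIntegral_cross_erase_le E hE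
  refine ⟨c, C, c₀, hc, hC, hc₀, fun δ t r n L M hδ ht ht2 hr hrL hL1 hgap hsep hc₀M h4 gtot G' hg hG' ↦ ?_⟩
  obtain rfl : gtot = _ := funext hg
  subst hG'
  have hLM : ∀ j, L j < M j := fun j ↦ by linarith [hgap j]
  have hL : ∀ j, 0 < L j := fun j ↦ one_pos.trans_le (hL1 j)
  set g : E.Ω → ℝ := fun ω ↦ ∏ᶠ u ∈ Tow(E.X δ ω, n + 1, L, M, r),
    u.nestingFactor (Stair(n + 1, L, M, t, r)).density with hgdef
  set G : Set E.Ω := {ω | Good(E.X δ ω, n + 1, L, M)} with hGdef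
  have hgi : Integrable g E.P := integrable_finprod_tow E hE hδ (Nat.succ_pos n) hr hrL hL hLM hsep
  have hw0 : 0 ≤ magicWeight t := magicWeight_nonneg_of_mem_Icc ⟨ht.1, by linarith [ht.2, Real.pi_pos]⟩
  have hw1 := one_le_gapWeight ht.2 ht2 (n := n)
  have hg0 : ∀ ω, 0 ≤ g ω := fun ω ↦ by
    simp only [hgdef]
    rw [finprod_tow_eq_pow_mul_prod E hE hδ ω hr hrL hL1 hLM hsep]
    exact mul_nonneg (pow_nonneg hw0 _) (Finset.prod_nonneg fun i _ ↦ pow_nonneg (zero_le_one.trans (hw1 i)) _)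
  have hGm : MeasurableSet G := measurableSet_good E hE δ (n + 1) L M
  have hind1 : ∀ ω, ω ∈ G → G.indicator (1 : E.Ω → ℝ) ω = 1 := fun ω hω ↦ Set.indicator_of_mem hω _
  have hind0 : ∀ ω, ω ∉ G → G.indicator (1 : E.Ω → ℝ) ω = 0 := fun ω hω ↦ Set.indicator_of_notMem hω _
  have hup : ∫ ω, g ω * G.indicator 1 ω ∂E.P ≤ ∫ ω, g ω ∂E.P := by
    refine integral_mono_of_nonneg (Eventually.of_forall fun ω ↦ ?_) hgi (Eventually.of_forall fun ω ↦ ?_)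
    · show 0 ≤ g ω * G.indicator 1 ω
      by_cases hω : ω ∈ G
      · rw [hind1 ω hω, mul_one]; exact hg0 ω
      · rw [hind0 ω hω, mul_zero]
    · show g ω * G.indicator 1 ω ≤ g ω
      by_cases hω : ω ∈ G
      · rw [hind1 ω hω, mul_one]
      · rw [hind0 ω hω, mul_zero]; exact hg0 ω
  refine ⟨hgi, hg0, hup, ?_⟩
  have hsplit : ∫ ω, g ω * G.indicator 1 ω ∂E.P = ∫ ω, g ω ∂E.P - ∫ ω, g ω * Gᶜ.indicator 1 ω ∂E.P := by
    rw [← integral_sub hgi]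
    · refine integral_congr_ae (Eventually.of_forall fun ω ↦ ?_)
      show g ω * G.indicator 1 ω = g ω - g ω * Gᶜ.indicator 1 ω
      by_cases hω : ω ∈ G
      · rw [hind1 ω hω, Set.indicator_of_notMem (Set.notMem_compl_iff.2 hω), mul_one, mul_zero, sub_zero]
      · rw [hind0 ω hω, Set.indicator_of_mem (Set.mem_compl hω), Pi.one_apply, mul_one, mul_zero, sub_self]
    · refine (hgi.indicator hGm.compl).congr (Eventually.of_forall fun ω ↦ ?_)
      show Gᶜ.indicator g ω = g ω * Gᶜ.indicator 1 ω
      by_cases hω : ω ∈ Gᶜ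
      · rw [Set.indicator_of_mem hω, Set.indicator_of_mem hω, Pi.one_apply, mul_one]
      · rw [Set.indicator_of_notMem hω, Set.indicator_of_notMem hω, mul_zero]
  have hmeas : ∀ j ∈ (Finset.univ : Finset (Fin n)),
      MeasurableSet LCross(E, δ, M (Fin.castSucc j), L (Fin.succ j)) :=
    fun j _ ↦ measurableSet_exists_loop E hE δ _
  have hbad : ∫ ω, g ω * Gᶜ.indicator 1 ω ∂E.P ≤
      (∑ j : Fin n, C * (M (Fin.castSucc j) / L (Fin.succ j)) ^ c) * ∫ ω, g ω ∂E.P := by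
    refine (integral_mul_indicator_compl_le_sum Finset.univ hmeas
      (compl_good_subset_iUnion hLM hsep E δ) hg0 hgi).trans ?_
    rw [Finset.sum_mul]
    refine Finset.sum_le_sum fun j _ ↦ ?_
    obtain ⟨hm, hi⟩ := integrable_erase E hE hδ ht ht2 hr hrL hL1 hLM hsep j
    have hnn : 0 ≤ C * (M (Fin.castSucc j) / L (Fin.succ j)) ^ c :=
      mul_nonneg hC.le (Real.rpow_nonneg (div_nonneg ((hL _).trans (hLM _)).le (hL _).le) _)
    calc ∫ ω in LCross(E, δ, M (Fin.castSucc j), L (Fin.succ j)), g ω ∂E.P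
        = ∫ ω in LCross(E, δ, M (Fin.castSucc j), L (Fin.succ j)),
            GapErase(E.X δ ω, t, r, n, L, M, j) ∂E.P :=
          setIntegral_congr_fun (hmeas j (Finset.mem_univ j)) fun ω hω ↦
            finprod_tow_eq_erase_of_cross E hE hδ ω hr hrL hL1 hLM hsep j hω
      _ ≤ C * (M (Fin.castSucc j) / L (Fin.succ j)) ^ c *
            ∫ ω, GapErase(E.X δ ω, t, r, n, L, M, j) ∂E.P :=
          hbd hδ ht ht2 hr hrL hL1 hgap hsep j (hc₀M j) (h4 j)
      _ ≤ C * (M (Fin.castSucc j) / L (Fin.succ j)) ^ c * ∫ ω, g ω ∂E.P :=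
          mul_le_mul_of_nonneg_left (integral_mono hi hgi fun ω ↦
            (erase_le_finprod_tow E hE hδ ω ht ht2 hr hrL hL1 hLM hsep j).2) hnn
  rw [hsplit, sub_mul, one_mul]
  linarith

end Summit.CriticalPhenomena.CardyFormulaZ2.Cruxes.NestingRigidity.RingCloudTomography

end
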